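import Mathlib
import HarnessLib
import Literature.Analysis.Complex.JensenPolynomialHyperbolicity
import Summits.ValiantsHypothesis.ValiantsHypothesis.Theorems.LacunarySymmetroidMatrixDescartesOsculationLawRankOneCurve

/-!
# ValiantsHypothesis / LacunarySymmetroid — crux `MatrixDescartes` (stmt-ValiantsHypothesis-18050, V1),
# line `Cruxes/MatrixDescartes/Lines/osculation_law.lean` («osculation-law»), stub `stub_peel` (ALL ranks):
# THE COEFFICIENT FORM OF THE LETTER AND ITS REFLECTION `b ↦ 1/b` (reversal sub-brick of NOTE-p7g12 §6 (γ4)(iii))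

Rank-free, pencil-free.  The spectral curve of a rank-`r` letter is, by val-lit-p5 g11's
`OsculationLetter.insertionPoly_rank_card`, in COEFFICIENT FORM `Φ = Σ_{k ≤ r} X₁^k · ι(a_k)` with `a_k ∈ ℝ[t]`, and its
vertical family is `P t = Σ_{k ≤ r} X^k · C(a_k(t))` (`OsculationLetter.letter_poly_at`).  ESCAPE ends (`β → +∞`) are
ZERO ends of the REFLECTED family `u ↦ u^r · P t (1/u) = Σ_k X^k · C(a_{r−k}(t))` — the same coefficient form with the
coefficients reversed — so the zero-end machinery (`…PeelEndMultiplicity`, `…PeelBranchOrdering`) serves both: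
* `eval_coeffForm` — `(P t)(b) = Φ(t, b)` (the `hP` of every Peel file, for the coefficient form);
* `eval_zero_coeffForm`, `natDegree_coeffForm_le`, `coeff_coeffForm_of_lt` — bookkeeping;
* `reflect_coeffForm` — `reflect r (P t)` is the coefficient form of the reversed coefficients;
* `splits_coeffForm_reflect` — hyperbolicity transfers to the reflected family (the tree's
  `Literature.Analysis.Complex.PolyaSchur.splits_reflect`, cited by name);
* `eval_reflect_inv_mul_pow`, `isRoot_reflect_inv` — `b ≠ 0` is a root of `f` iff `1/b` is a root of `reflect N f`.
Honest framing: a rank-free LEMMA file toward the OPEN stub `stub_peel` (all `r`); nothing of the summit is proved;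
`MatrixDescartes`, the LAW and `VP ≠ VNP` are NOT proved.  No definitions, no named facts.  (val-lit-p4 g13, helper
`--supports stmt-ValiantsHypothesis-18050`; desk RULING #279 (a).)
-/

-- `Summit.ValiantsHypothesis.ValiantsHypothesis.…` is the tree's mandated single-conjunct layout (Sub = Summit).
set_option linter.dupNamespace false

noncomputable section

namespace Summit.ValiantsHypothesis.ValiantsHypothesis.Theorems.LacunarySymmetroidMatrixDescartes

open Polynomial Set Filter
open scoped BigOperators Topology

namespace OsculationPeel

/-! ### The coefficient form -/

/-- **`hP` for the coefficient form**: `(Σ_k X^k C(a_k(t)))(b) = Φ(t,b)` for `Φ = Σ_k X₁^k · ι(a_k)`. [folklore] -/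
theorem eval_coeffForm (r : ℕ) (a : ℕ → ℝ[X]) (t b : ℝ) :
    (∑ k ∈ Finset.range (r + 1), (X : ℝ[X]) ^ k * Polynomial.C ((a k).eval t)).eval b =
      MvPolynomial.eval ![t, b] (∑ k ∈ Finset.range (r + 1), (MvPolynomial.X 1 : MvPolynomial (Fin 2) ℝ) ^ k *
        Polynomial.aeval (MvPolynomial.X 0 : MvPolynomial (Fin 2) ℝ) (a k)) := by
  rw [eval_finsetSum, map_sum]
  refine Finset.sum_congr rfl fun k _ => ?_
  rw [eval_mul, eval_pow, eval_X, eval_C, map_mul, map_pow, MvPolynomial.eval_X, OsculationRankOne.eval_aevalX0]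
  rfl

/-- The value at `b = 0` is the bottom coefficient `a₀(t)`. [folklore] -/
theorem eval_zero_coeffForm (r : ℕ) (a : ℕ → ℝ[X]) (t : ℝ) :
    (∑ k ∈ Finset.range (r + 1), (X : ℝ[X]) ^ k * Polynomial.C ((a k).eval t)).eval 0 = (a 0).eval t := by
  rw [eval_finsetSum, Finset.sum_eq_single 0]
  · simp
  · intro k _ hk
    simp [zero_pow hk]
  · intro h; simp at h

/-- The coefficient form has degree `≤ r`. [folklore] -/
theorem natDegree_coeffForm_le (r : ℕ) (a : ℕ → ℝ[X]) (t : ℝ) :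
    (∑ k ∈ Finset.range (r + 1), (X : ℝ[X]) ^ k * Polynomial.C ((a k).eval t)).natDegree ≤ r := by
  refine Polynomial.natDegree_sum_le_of_forall_le _ _ fun k hk => ?_
  rw [Finset.mem_range] at hk
  calc ((X : ℝ[X]) ^ k * Polynomial.C ((a k).eval t)).natDegree ≤ ((X : ℝ[X]) ^ k).natDegree + (Polynomial.C ((a k).eval t)).natDegree :=
        natDegree_mul_le
    _ ≤ k + 0 := by rw [natDegree_C]; exact Nat.add_le_add_right (natDegree_X_pow_le k) 0
    _ ≤ r := by omega

/-- The coefficients of the coefficient form. [folklore] -/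
theorem coeff_coeffForm (r : ℕ) (a : ℕ → ℝ[X]) (t : ℝ) (i : ℕ) :
    (∑ k ∈ Finset.range (r + 1), (X : ℝ[X]) ^ k * Polynomial.C ((a k).eval t)).coeff i =
      if i < r + 1 then (a i).eval t else 0 := by
  rw [finsetSum_coeff]
  simp_rw [mul_comm ((X : ℝ[X]) ^ _) (Polynomial.C _), coeff_C_mul_X_pow]
  rw [Finset.sum_ite_eq (Finset.range (r + 1)) i]
  simp only [Finset.mem_range]

/-! ### The reflection -/

/-- **The reflected family is the coefficient form of the reversed coefficients**:
`reflect r (Σ_{k≤r} X^k C(a_k(t))) = Σ_{k≤r} X^k C(a_{r−k}(t))`. [folklore] -/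
theorem reflect_coeffForm (r : ℕ) (a : ℕ → ℝ[X]) (t : ℝ) :
    reflect r (∑ k ∈ Finset.range (r + 1), (X : ℝ[X]) ^ k * Polynomial.C ((a k).eval t)) =
      ∑ k ∈ Finset.range (r + 1), (X : ℝ[X]) ^ k * Polynomial.C ((a (r - k)).eval t) := by
  ext i
  rw [coeff_reflect, coeff_coeffForm, coeff_coeffForm]
  by_cases hi : i ≤ r
  · rw [revAt_le hi, if_pos (by omega), if_pos (by omega)]
  · rw [revAt_eq_self_of_lt (not_le.1 hi), if_neg (by omega), if_neg (by omega)]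

/-- **Roots transfer under reflection**: for `b ≠ 0`, `(reflect N f)(b⁻¹) · b^N = f(b)`. [Mathlib
`eval₂_reflect_mul_pow`] -/
theorem eval_reflect_inv_mul_pow (f : ℝ[X]) {N : ℕ} (hf : f.natDegree ≤ N) {b : ℝ} (hb : b ≠ 0) :
    (reflect N f).eval b⁻¹ * b ^ N = f.eval b := by
  letI : Invertible b := invertibleOfNonzero hb
  have h := eval₂_reflect_mul_pow (RingHom.id ℝ) b N f hf
  rw [invOf_eq_inv] at h
  simpa [eval₂_id] using h

/-- For `b ≠ 0`: `b` is a root of `f` iff `b⁻¹` is a root of `reflect N f` (`natDegree f ≤ N`). [folklore] -/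
theorem isRoot_reflect_inv_iff (f : ℝ[X]) {N : ℕ} (hf : f.natDegree ≤ N) {b : ℝ} (hb : b ≠ 0) :
    (reflect N f).IsRoot b⁻¹ ↔ f.IsRoot b := by
  rw [IsRoot, IsRoot, ← eval_reflect_inv_mul_pow f hf hb]
  constructor
  · intro h; rw [h, zero_mul]
  · intro h
    rcases mul_eq_zero.1 h with h | h
    · exact h
    · exact absurd (eq_zero_of_pow_eq_zero h) hb

/-- The reflected coefficient form is the zero polynomial only if the original is. [folklore] -/
theorem coeffForm_reflect_ne_zero (r : ℕ) (a : ℕ → ℝ[X]) (t : ℝ)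
    (h : (∑ k ∈ Finset.range (r + 1), (X : ℝ[X]) ^ k * Polynomial.C ((a k).eval t)) ≠ 0) :
    (∑ k ∈ Finset.range (r + 1), (X : ℝ[X]) ^ k * Polynomial.C ((a (r - k)).eval t)) ≠ 0 := by
  rw [← reflect_coeffForm]
  exact fun h0 => h (reflect_eq_zero_iff.1 h0)

/-- **Splitting of the reflected family** from the splitting of the family. [folklore] -/
theorem splits_coeffForm_reflect (r : ℕ) (a : ℕ → ℝ[X]) (t : ℝ)
    (h : (∑ k ∈ Finset.range (r + 1), (X : ℝ[X]) ^ k * Polynomial.C ((a k).eval t)).Splits) :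
    (∑ k ∈ Finset.range (r + 1), (X : ℝ[X]) ^ k * Polynomial.C ((a (r - k)).eval t)).Splits := by
  rw [← reflect_coeffForm]
  exact Literature.Analysis.Complex.PolyaSchur.splits_reflect h (natDegree_coeffForm_le r a t)

/-- **Escapes are zeros of the reflected family**: a root `b ≠ 0` of the family is the root `b⁻¹` of the reflected
family, in the `Φ`-currency of the Peel files. [folklore] -/
theorem eval_reflect_coeffForm_inv (r : ℕ) (a : ℕ → ℝ[X]) (t : ℝ) {b : ℝ} (hb : b ≠ 0)
    (h : MvPolynomial.eval ![t, b] (∑ k ∈ Finset.range (r + 1), (MvPolynomial.X 1 : MvPolynomial (Fin 2) ℝ) ^ k *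
        Polynomial.aeval (MvPolynomial.X 0 : MvPolynomial (Fin 2) ℝ) (a k)) = 0) :
    MvPolynomial.eval ![t, b⁻¹] (∑ k ∈ Finset.range (r + 1), (MvPolynomial.X 1 : MvPolynomial (Fin 2) ℝ) ^ k *
        Polynomial.aeval (MvPolynomial.X 0 : MvPolynomial (Fin 2) ℝ) (a (r - k))) = 0 := by
  rw [← eval_coeffForm, ← reflect_coeffForm]
  rw [← eval_coeffForm] at h
  exact ((isRoot_reflect_inv_iff _ (natDegree_coeffForm_le r a t) hb).2 h :)

end OsculationPeel

end Summit.ValiantsHypothesis.ValiantsHypothesis.Theorems.LacunarySymmetroidMatrixDescartes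

end
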